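import Summits.Ventures.PercRepro.C041CutGlueBound
import Summits.Ventures.PercRepro.C041CSCount

/-!
# LEMMA G-CS — CONJECTURE (CS) GLUES AT A CUT VERTEX, WITH (INV) AS THE ONLY EXTRA INPUT (p6, gen 28; mine-3's
C-041.md §17 (b))

Setting of `C041CutGlueDefs` (gen 25): a weighted state space `Space X` with the Good bits and validity, and the
GLUE `glue P ρ₁ ρ₂ Q` on `Y × X` (`Good_t = G_t^σ ∨ (ρ_t^σ ∧ G_t″)`, `valid = V^σ ∨ V″`).  In `ℤ` the (CS)
predicate reads `CSInt v x y := (max (v − x − y) 0)² ≤ x·y` (`Space.CSZ S` for the three weighted counts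
`NV`, `cnt G₁`, `cnt G₂`); it agrees with the `ℕ` form `CSCount.CS` on natural counts (`csInt_of_cs`).

* THE THREE COUNT IDENTITIES OF THE GLUE (`cnt_glue_or_and`, the paper's `v = v_σN″ + I_σV″`,
  `x = x_σN″ + m₁X″`, `y = y_σN″ + m₂Y″`): `glue_NV`, `glue_cnt_G₁`, `glue_cnt_G₂`;
* the arithmetic **`csZ_glue_counts`**: from (CS) for `(v_σ, x_σ, y_σ)` and `(V″, X″, Y″)` and `I_σ ≤ m₁, m₂`
  (CONJECTURE (INV), a theorem by `C041ZoneZSkelINV`): `max(v − x − y, 0) ≤ d·N″ + I_σ·D` with `d`, `D` the two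
  positive excesses, and `(dN″ + I_σD)² ≤ (x_σN″ + m₁X″)(y_σN″ + m₂Y″)` by the two-term CAUCHY–SCHWARZ step
  (`cs_add_int`, from `C041CSCount.cs_add`) with `d² ≤ x_σy_σ` and `I_σ²D² ≤ m₁m₂X″Y″`;
* **`csZ_glue`** — LEMMA G-CS: (CS) for the gadget and for the sub-problem, with (INV) `I ≤ m₁ ρ₁`, `I ≤ m₂ ρ₂`,
  gives (CS) for the glue.  Hence the BLOCK-TREE REDUCTION of C-041.md §10 (b) / §13 holds for (CS) verbatim at
  this abstract level, (INV) being a theorem.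
-/

namespace PercRepro

namespace CutGlue

open Finset CSCount

/-! ## (CS) in `ℤ` -/

/-- The (CS) predicate on integer counts: `(max (v − x − y) 0)² ≤ x·y`. -/
def CSInt (v x y : ℤ) : Prop := (max (v - x - y) 0) ^ 2 ≤ x * y

/-- The `ℕ` form gives the `ℤ` form on natural counts. -/
theorem csInt_of_cs {v x y : ℕ} (h : CS v x y) : CSInt v x y := by
  unfold CSInt
  unfold CS at h
  have e : max ((v : ℤ) - x - y) 0 = ((v - x - y : ℕ) : ℤ) := by omega
  rw [e]
  exact_mod_cast h

/-- The two-term CAUCHY–SCHWARZ step in `ℤ`, for nonnegative entries. -/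
theorem cs_add_int {a b c a' b' c' : ℤ} (ha : 0 ≤ a) (hb : 0 ≤ b) (hc : 0 ≤ c) (ha' : 0 ≤ a') (hb' : 0 ≤ b')
    (hc' : 0 ≤ c') (h : c ^ 2 ≤ a * b) (h' : c' ^ 2 ≤ a' * b') : (c + c') ^ 2 ≤ (a + a') * (b + b') := by
  lift a to ℕ using ha
  lift b to ℕ using hb
  lift c to ℕ using hc
  lift a' to ℕ using ha'
  lift b' to ℕ using hb'
  lift c' to ℕ using hc'
  exact_mod_cast cs_add (by exact_mod_cast h) (by exact_mod_cast h')

/-- **The arithmetic of LEMMA G-CS**: with `d := max (v_σ − x_σ − y_σ) 0`, `D := max (V − X − Y) 0`,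
`I := N_σ − v_σ ≤ m₁, m₂`, (CS) for both pieces gives (CS) for `(v_σN + I·V, x_σN + m₁X, y_σN + m₂Y)`. -/
theorem csZ_glue_counts {vσ xσ yσ I N V X Y m₁ m₂ : ℤ} (hxσ : 0 ≤ xσ) (hyσ : 0 ≤ yσ) (hI : 0 ≤ I) (hN : 0 ≤ N)
    (hX : 0 ≤ X) (hY : 0 ≤ Y) (hσ : CSInt vσ xσ yσ) (hQ : CSInt V X Y) (h₁ : I ≤ m₁) (h₂ : I ≤ m₂) :
    CSInt (vσ * N + I * V) (xσ * N + m₁ * X) (yσ * N + m₂ * Y) := by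
  unfold CSInt at hσ hQ ⊢
  set d := max (vσ - xσ - yσ) 0 with hd
  set D := max (V - X - Y) 0 with hD
  have hd0 : 0 ≤ d := le_max_right _ _
  have hD0 : 0 ≤ D := le_max_right _ _
  have hdv : vσ - xσ - yσ ≤ d := le_max_left _ _
  have hDv : V - X - Y ≤ D := le_max_left _ _
  -- the excess of the glue is at most `d·N + I·D`
  have hexc : max (vσ * N + I * V - (xσ * N + m₁ * X) - (yσ * N + m₂ * Y)) 0 ≤ d * N + I * D := by
    have e1 : (vσ - xσ - yσ) * N ≤ d * N := mul_le_mul_of_nonneg_right hdv hN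
    have e2 : I * (V - X - Y) ≤ I * D := mul_le_mul_of_nonneg_left hDv hI
    have e3 : I * X ≤ m₁ * X := mul_le_mul_of_nonneg_right h₁ hX
    have e4 : I * Y ≤ m₂ * Y := mul_le_mul_of_nonneg_right h₂ hY
    have e5 : 0 ≤ d * N + I * D := add_nonneg (mul_nonneg hd0 hN) (mul_nonneg hI hD0)
    apply max_le _ e5
    nlinarith [e1, e2, e3, e4]
  -- the two squares
  have hc₁ : (d * N) ^ 2 ≤ (xσ * N) * (yσ * N) := by
    calc (d * N) ^ 2 = d ^ 2 * N ^ 2 := by ring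
      _ ≤ (xσ * yσ) * N ^ 2 := mul_le_mul_of_nonneg_right hσ (sq_nonneg N)
      _ = (xσ * N) * (yσ * N) := by ring
  have hI2 : I * I ≤ m₁ * m₂ := mul_le_mul h₁ h₂ hI (le_trans hI h₁)
  have hc₂ : (I * D) ^ 2 ≤ (m₁ * X) * (m₂ * Y) := by
    calc (I * D) ^ 2 = (I * I) * D ^ 2 := by ring
      _ ≤ (m₁ * m₂) * (X * Y) := mul_le_mul hI2 hQ (sq_nonneg D) (mul_nonneg (le_trans hI h₁) (le_trans hI h₂))
      _ = (m₁ * X) * (m₂ * Y) := by ring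
  have hsum : (d * N + I * D) ^ 2 ≤ (xσ * N + m₁ * X) * (yσ * N + m₂ * Y) :=
    cs_add_int (mul_nonneg hxσ hN) (mul_nonneg hyσ hN) (mul_nonneg hd0 hN)
      (mul_nonneg (le_trans hI h₁) hX) (mul_nonneg (le_trans hI h₂) hY) (mul_nonneg hI hD0) hc₁ hc₂
  calc (max (vσ * N + I * V - (xσ * N + m₁ * X) - (yσ * N + m₂ * Y)) 0) ^ 2
      ≤ (d * N + I * D) ^ 2 := pow_le_pow_left₀ (le_max_right _ _) hexc 2
    _ ≤ (xσ * N + m₁ * X) * (yσ * N + m₂ * Y) := hsum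

/-! ## The three count identities of the glue -/

variable {Y X : Type*} [Fintype Y] [Fintype X]

open Classical in
/-- **The weighted count of an «or-and» predicate on the glue**: `#_w{p^σ ∨ (q^σ ∧ r″)} = #_w{p}·N″ +
#_w{¬p ∧ q}·#_w{r}`. -/
theorem cnt_glue_or_and (P : Space Y) (ρ₁ ρ₂ : Y → Prop) (Q : Space X) (p q : Y → Prop) (r : X → Prop) :
    (glue P ρ₁ ρ₂ Q).cnt (fun s => p s.1 ∨ (q s.1 ∧ r s.2)) = P.cnt p * Q.N + P.cnt (fun σ => ¬ p σ ∧ q σ) * Q.cnt r := by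
  unfold Space.cnt
  rw [Fintype.sum_prod_type]
  dsimp only
  rw [Finset.sum_mul, Finset.sum_mul, ← Finset.sum_add_distrib]
  apply Finset.sum_congr rfl
  intro σ _
  by_cases hp : p σ
  · rw [if_pos hp, if_neg (fun h => h.1 hp), zero_mul, add_zero]
    unfold Space.N Space.cnt
    rw [Finset.mul_sum]
    apply Finset.sum_congr rfl
    intro x _
    rw [if_pos (Or.inl hp), if_pos trivial, glue_w]
    push_cast
    ring
  · rw [if_neg hp, zero_mul, zero_add]
    by_cases hq : q σ
    · rw [if_pos ⟨hp, hq⟩, Finset.mul_sum]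
      apply Finset.sum_congr rfl
      intro x _
      by_cases hr : r x
      · rw [if_pos (Or.inr ⟨hq, hr⟩), if_pos hr, glue_w]
        push_cast
        ring
      · rw [if_neg (fun h => h.elim hp fun h' => hr h'.2), if_neg hr, mul_zero]
    · rw [if_neg (fun h => hq h.2), zero_mul]
      apply Finset.sum_eq_zero
      intro x _
      rw [if_neg (fun h => h.elim hp fun h' => hq h'.1)]

/-- **`NV(glue) = NV(P)·N″ + I(P)·NV″`** (the paper's `v = v_σN″ + I_σV″`). -/
theorem glue_NV (P : Space Y) (ρ₁ ρ₂ : Y → Prop) (Q : Space X) :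
    (glue P ρ₁ ρ₂ Q).NV = P.NV * Q.N + P.I * Q.NV := by
  have h := cnt_glue_or_and P ρ₁ ρ₂ Q P.V (fun _ => True) Q.V
  have e1 : (glue P ρ₁ ρ₂ Q).NV = (glue P ρ₁ ρ₂ Q).cnt (fun s => P.V s.1 ∨ ((fun _ : Y => True) s.1 ∧ Q.V s.2)) :=
    (glue P ρ₁ ρ₂ Q).cnt_congr fun s => by
      rw [glue_V]
      simp only [true_and]
  have e2 : P.cnt (fun σ => ¬ P.V σ ∧ (fun _ : Y => True) σ) = P.I :=
    P.cnt_congr fun σ => by simp only [and_true]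
  rw [e1, h, e2]
  rfl

/-- **`#Good₁(glue) = #Good₁(P)·N″ + m₁·#Good₁″`** (the paper's `x = x_σN″ + m₁X″`). -/
theorem glue_cnt_G₁ (P : Space Y) (ρ₁ ρ₂ : Y → Prop) (Q : Space X) :
    (glue P ρ₁ ρ₂ Q).cnt (glue P ρ₁ ρ₂ Q).G₁ = P.cnt P.G₁ * Q.N + P.m₁ ρ₁ * Q.cnt Q.G₁ := by
  unfold Space.m₁
  exact cnt_glue_or_and P ρ₁ ρ₂ Q P.G₁ ρ₁ Q.G₁

/-- **`#Good₂(glue) = #Good₂(P)·N″ + m₂·#Good₂″`** (the paper's `y = y_σN″ + m₂Y″`). -/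
theorem glue_cnt_G₂ (P : Space Y) (ρ₁ ρ₂ : Y → Prop) (Q : Space X) :
    (glue P ρ₁ ρ₂ Q).cnt (glue P ρ₁ ρ₂ Q).G₂ = P.cnt P.G₂ * Q.N + P.m₂ ρ₂ * Q.cnt Q.G₂ := by
  unfold Space.m₂
  exact cnt_glue_or_and P ρ₁ ρ₂ Q P.G₂ ρ₂ Q.G₂

/-! ## LEMMA G-CS -/

/-- **CONJECTURE (CS) on a weighted state space**: `(max (NV − #Good₁ − #Good₂) 0)² ≤ #Good₁ · #Good₂`. -/
def Space.CSZ {X : Type*} [Fintype X] (S : Space X) : Prop := CSInt S.NV (S.cnt S.G₁) (S.cnt S.G₂)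

/-- **LEMMA G-CS** (mine-3, C-041.md §17 (b)): (CS) for the gadget and for the sub-problem, together with (INV) for
the gadget (`I ≤ m₁ ρ₁`, `I ≤ m₂ ρ₂`), give (CS) for the glue. -/
theorem csZ_glue (P : Space Y) (ρ₁ ρ₂ : Y → Prop) (Q : Space X) (hP : P.CSZ) (hQ : Q.CSZ)
    (h₁ : P.I ≤ P.m₁ ρ₁) (h₂ : P.I ≤ P.m₂ ρ₂) : (glue P ρ₁ ρ₂ Q).CSZ := by
  unfold Space.CSZ at hP hQ ⊢
  rw [glue_NV, glue_cnt_G₁, glue_cnt_G₂]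
  exact csZ_glue_counts (P.cnt_nonneg _) (P.cnt_nonneg _) P.I_nonneg Q.N_nonneg (Q.cnt_nonneg _) (Q.cnt_nonneg _)
    hP hQ h₁ h₂

end CutGlue

end PercRepro
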